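import Mathlib
import Summits.Ventures.PercRepro2.Defs
import Summits.Ventures.PercRepro2.Independence
import Summits.Ventures.PercRepro2.Harris
import Summits.Ventures.PercRepro2.Graph
import Summits.Ventures.PercRepro2.Exploration
import Summits.Ventures.PercRepro2.Events
import Summits.Ventures.PercRepro2.Induced
import Summits.Ventures.PercRepro2.BoxUnionDefs
import Summits.Ventures.PercRepro2.BoxUnion
import Summits.Ventures.PercRepro2.BoxUnionPair
import Summits.Ventures.PercRepro2.PairTP2
import Summits.Ventures.PercRepro2.PairTP2Main
import Summits.Ventures.PercRepro2.SeparatedDefs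

/-!
# (PAIR-TP2) is sharp: the path `s – u – v – t`
(blind cell PercRepro2, mine-1 g39; proofs/MINE1-PAIRTP2.md §2′, the smallest instance)

`PairTP2.pairLaw_lsm_of_not_linkable_or_not_interfaced` says: for `u ≠ v` off the terminals,
if `(u, v)` is NOT linkable or `u, v` lie in different components of `G − {s, t}`, the two-vertex
status law `pairLaw p ends {u, v} s t` is log-supermodular on the (Z)-lattice for every weight
vector. This file shows the hypothesis cannot be dropped, on the smallest instance: the path
`0 – 1 – 2 – 3` with `s = 0, u = 1, v = 2, t = 3`. There `(u, v)` IS linkable (the configuration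
`10 1` has `u ∈ C_s, v ∈ C_t` on `{s ↮ t}`) and `u, v` ARE interfaced (the middle edge joins them
in `G − {s, t}`), and for EVERY interior weight vector `p ∈ (0, 1)^3` the status law fails
log-supermodularity at the pair `(S, T), (N, N)`, by the exact identity

  `M(S,T) · M(N,N) − M(N,T) · M(S,N) = p₀ p₁ p₂ (1 − p₀)(1 − p₁)(1 − p₂) > 0`

(`M(S,T) = p₀ (1 − p₁) p₂`, `M(N,N) = (1 − p₀)(1 − p₂)` — the interface edge is FREE —,
`M(N,T) = (1 − p₀)(1 − p₁) p₂`, `M(S,N) = p₀ (1 − p₁)(1 − p₂)`). The four masses are cylinder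
probabilities (`prob_cylinder`) once the connection events of the path are read off edge by edge
(`conn_01` … `conn_31`, by the closure lemma `mem_of_conn_of_closed`).
-/

namespace Summit.Ventures.PercRepro2

namespace PairTP2Path

open Finset
open scoped Classical

/-! ### The path on four vertices -/

/-- The path `0 – 1 – 2 – 3`: edge `i` joins `i` and `i + 1`. -/
def pathEnds : Fin 3 → Sym2 (Fin 4) := fun i => s(i.castSucc, i.succ)

/-- Edge `0` joins `0` and `1`. -/
lemma pathEnds_zero : pathEnds 0 = s(0, 1) := rfl

/-- Edge `1` joins `1` and `2`. -/
lemma pathEnds_one : pathEnds 1 = s(1, 2) := rfl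

/-- Edge `2` joins `2` and `3`. -/
lemma pathEnds_two : pathEnds 2 = s(2, 3) := rfl

/-- The three edges. -/
lemma fin3_cases (e : Fin 3) : e = 0 ∨ e = 1 ∨ e = 2 := by revert e; decide

/-! ### Connections on the path, edge by edge -/

/-- A closed edge `k` separates the vertices `≤ k` from the vertices `> k`. -/
lemma not_conn_of_closed (ω : Config (Fin 3)) (k : Fin 3) (hk : ω k = false)
    {x y : Fin 4} (hx : x.val ≤ k.val) (hy : k.val < y.val) :
    ¬ Conn pathEnds ω x y := by
  intro h
  have hmem : y ∈ {z : Fin 4 | z.val ≤ k.val} := by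
    refine mem_of_conn_of_closed (S := {z : Fin 4 | z.val ≤ k.val}) ?_ hx h
    intro a ha b hab
    rw [openGraph_adj] at hab
    obtain ⟨-, e, he, hends⟩ := hab
    simp only [Set.mem_setOf_eq] at ha ⊢
    have hek : e.val ≠ k.val := by
      intro h'
      have : e = k := Fin.ext h'
      subst this
      rw [hk] at he
      exact Bool.false_ne_true he
    unfold pathEnds at hends
    rw [Sym2.eq_iff] at hends
    rcases hends with ⟨rfl, rfl⟩ | ⟨rfl, rfl⟩
    · simp only [Fin.val_castSucc, Fin.val_succ] at ha ⊢
      omega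
    · simp only [Fin.val_castSucc, Fin.val_succ] at ha ⊢
      omega
  simp only [Set.mem_setOf_eq] at hmem
  omega

/-- Edge `0` open: `0 ↔ 1`. -/
lemma conn_e0 {ω : Config (Fin 3)} (h : ω 0 = true) : Conn pathEnds ω 0 1 :=
  conn_of_openAdj ⟨0, h, rfl⟩

/-- Edge `1` open: `1 ↔ 2`. -/
lemma conn_e1 {ω : Config (Fin 3)} (h : ω 1 = true) : Conn pathEnds ω 1 2 :=
  conn_of_openAdj ⟨1, h, rfl⟩

/-- Edge `2` open: `2 ↔ 3`. -/
lemma conn_e2 {ω : Config (Fin 3)} (h : ω 2 = true) : Conn pathEnds ω 2 3 :=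
  conn_of_openAdj ⟨2, h, rfl⟩

/-- `0 ↔ 1` iff edge `0` is open. -/
lemma conn_01 (ω : Config (Fin 3)) : Conn pathEnds ω 0 1 ↔ ω 0 = true := by
  constructor
  · intro h
    by_contra h0
    exact not_conn_of_closed ω 0 (by simpa using h0) (by decide) (by decide) h
  · exact conn_e0

/-- `0 ↔ 2` iff edges `0` and `1` are open. -/
lemma conn_02 (ω : Config (Fin 3)) : Conn pathEnds ω 0 2 ↔ ω 0 = true ∧ ω 1 = true := by
  constructor
  · intro h
    by_cases h0 : ω 0 = true
    · by_cases h1 : ω 1 = true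
      · exact ⟨h0, h1⟩
      · exact absurd h (not_conn_of_closed ω 1 (by simpa using h1) (by decide) (by decide))
    · exact absurd h (not_conn_of_closed ω 0 (by simpa using h0) (by decide) (by decide))
  · rintro ⟨h0, h1⟩
    exact conn_trans (conn_e0 h0) (conn_e1 h1)

/-- `0 ↔ 3` iff all three edges are open. -/
lemma conn_03 (ω : Config (Fin 3)) :
    Conn pathEnds ω 0 3 ↔ ω 0 = true ∧ ω 1 = true ∧ ω 2 = true := by
  constructor
  · intro h
    by_cases h0 : ω 0 = true
    · by_cases h1 : ω 1 = true
      · by_cases h2 : ω 2 = true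
        · exact ⟨h0, h1, h2⟩
        · exact absurd h (not_conn_of_closed ω 2 (by simpa using h2) (by decide) (by decide))
      · exact absurd h (not_conn_of_closed ω 1 (by simpa using h1) (by decide) (by decide))
    · exact absurd h (not_conn_of_closed ω 0 (by simpa using h0) (by decide) (by decide))
  · rintro ⟨h0, h1, h2⟩
    exact conn_trans (conn_trans (conn_e0 h0) (conn_e1 h1)) (conn_e2 h2)

/-- `3 ↔ 2` iff edge `2` is open. -/
lemma conn_32 (ω : Config (Fin 3)) : Conn pathEnds ω 3 2 ↔ ω 2 = true := by
  constructor
  · intro h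
    by_contra h2
    exact not_conn_of_closed ω 2 (by simpa using h2) (by decide) (by decide) (conn_symm h)
  · intro h2
    exact conn_symm (conn_e2 h2)

/-- `3 ↔ 1` iff edges `2` and `1` are open. -/
lemma conn_31 (ω : Config (Fin 3)) : Conn pathEnds ω 3 1 ↔ ω 2 = true ∧ ω 1 = true := by
  constructor
  · intro h
    by_cases h2 : ω 2 = true
    · by_cases h1 : ω 1 = true
      · exact ⟨h2, h1⟩
      · exact absurd (conn_symm h)
          (not_conn_of_closed ω 1 (by simpa using h1) (by decide) (by decide))
    · exact absurd (conn_symm h)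
        (not_conn_of_closed ω 2 (by simpa using h2) (by decide) (by decide))
  · rintro ⟨h2, h1⟩
    exact conn_symm (conn_trans (conn_e1 h1) (conn_e2 h2))

/-! ### The status code `1` (in neither cluster) -/

/-- The code is `1` iff the vertex lies in neither cluster. -/
lemma code_eq_one_iff {V : Type*} {E : Type*} [Fintype V] [DecidableEq V] [Fintype E]
    [DecidableEq E] (ends : E → Sym2 V) (s t : V) (ω : Config E) (x : V) :
    PairTP2.code ends s t ω x = 1 ↔ ¬ Conn ends ω s x ∧ ¬ Conn ends ω t x := by
  unfold PairTP2.code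
  split_ifs <;> simp [*]

/-! ### The four grid events are cylinders -/

/-- The configuration `(1, 0, 1)`: `u ∈ C_s`, `v ∈ C_t`. -/
def σST : Config (Fin 3) := fun e => decide (e ≠ 1)

/-- The configuration `(0, 0, 1)`: `u` in neither cluster, `v ∈ C_t`. -/
def σNT : Config (Fin 3) := fun e => decide (e = 2)

/-- The configuration `(1, 0, 0)`: `u ∈ C_s`, `v` in neither cluster. -/
def σSN : Config (Fin 3) := fun e => decide (e = 0)

/-- The configuration with edges `0` and `2` closed (edge `1` free): both in neither cluster. -/
def σNN : Config (Fin 3) := fun _ => false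

/-- `σST` on edge `0`. -/
lemma σST_zero : σST 0 = true := rfl
/-- `σST` on edge `1`. -/
lemma σST_one : σST 1 = false := rfl
/-- `σST` on edge `2`. -/
lemma σST_two : σST 2 = true := rfl
/-- `σNT` on edge `0`. -/
lemma σNT_zero : σNT 0 = false := rfl
/-- `σNT` on edge `1`. -/
lemma σNT_one : σNT 1 = false := rfl
/-- `σNT` on edge `2`. -/
lemma σNT_two : σNT 2 = true := rfl
/-- `σSN` on edge `0`. -/
lemma σSN_zero : σSN 0 = true := rfl
/-- `σSN` on edge `1`. -/
lemma σSN_one : σSN 1 = false := rfl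
/-- `σSN` on edge `2`. -/
lemma σSN_two : σSN 2 = false := rfl
/-- `σNN` on edge `0`. -/
lemma σNN_zero : σNN 0 = false := rfl
/-- `σNN` on edge `2`. -/
lemma σNN_two : σNN 2 = false := rfl

/-- Membership in a full cylinder on three edges. -/
lemma mem_cylinder_univ (σ ω : Config (Fin 3)) :
    ω ∈ cylinder Finset.univ σ ↔ ω 0 = σ 0 ∧ ω 1 = σ 1 ∧ ω 2 = σ 2 := by
  simp only [mem_cylinder, Finset.mem_univ, true_implies]
  constructor
  · intro h
    exact ⟨h 0, h 1, h 2⟩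
  · rintro ⟨h0, h1, h2⟩ e
    rcases fin3_cases e with rfl | rfl | rfl <;> assumption

/-- Membership in the cylinder on the edges `0` and `2`. -/
lemma mem_cylinder_02 (σ ω : Config (Fin 3)) :
    ω ∈ cylinder ({0, 2} : Finset (Fin 3)) σ ↔ ω 0 = σ 0 ∧ ω 2 = σ 2 := by
  simp only [mem_cylinder, Finset.mem_insert, Finset.mem_singleton]
  constructor
  · intro h
    exact ⟨h 0 (Or.inl rfl), h 2 (Or.inr rfl)⟩
  · rintro ⟨h0, h2⟩ e he
    rcases he with rfl | rfl <;> assumption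

/-- The grid event `(S, T)` is the cylinder `(1, 0, 1)`. -/
lemma gridEvent_ST :
    PairTP2.gridEvent pathEnds 0 3 1 2 (2, 0) = cylinder Finset.univ σST := by
  ext ω
  simp only [PairTP2.mem_gridEvent, PairTP2.code_eq_two_iff, PairTP2.code_eq_zero_iff,
    Set.mem_compl_iff, connEvent, Set.mem_setOf_eq, conn_01, conn_02, conn_03, conn_32,
    mem_cylinder_univ, σST_zero, σST_one, σST_two]
  cases h0 : ω 0 <;> cases h1 : ω 1 <;> cases h2 : ω 2 <;> simp

/-- The grid event `(N, N)` is the cylinder `(0, ·, 0)`: the interface edge is free. -/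
lemma gridEvent_NN :
    PairTP2.gridEvent pathEnds 0 3 1 2 (1, 1) = cylinder ({0, 2} : Finset (Fin 3)) σNN := by
  ext ω
  simp only [PairTP2.mem_gridEvent, code_eq_one_iff, Set.mem_compl_iff, connEvent,
    Set.mem_setOf_eq, conn_01, conn_02, conn_03, conn_32, conn_31, mem_cylinder_02, σNN_zero,
    σNN_two]
  cases h0 : ω 0 <;> cases h1 : ω 1 <;> cases h2 : ω 2 <;> simp

/-- The grid event `(N, T)` is the cylinder `(0, 0, 1)`. -/
lemma gridEvent_NT :
    PairTP2.gridEvent pathEnds 0 3 1 2 (1, 0) = cylinder Finset.univ σNT := by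
  ext ω
  simp only [PairTP2.mem_gridEvent, code_eq_one_iff, PairTP2.code_eq_zero_iff,
    Set.mem_compl_iff, connEvent, Set.mem_setOf_eq, conn_01, conn_02, conn_03, conn_32, conn_31,
    mem_cylinder_univ, σNT_zero, σNT_one, σNT_two]
  cases h0 : ω 0 <;> cases h1 : ω 1 <;> cases h2 : ω 2 <;> simp

/-- The grid event `(S, N)` is the cylinder `(1, 0, 0)`. -/
lemma gridEvent_SN :
    PairTP2.gridEvent pathEnds 0 3 1 2 (2, 1) = cylinder Finset.univ σSN := by
  ext ω
  simp only [PairTP2.mem_gridEvent, PairTP2.code_eq_two_iff, code_eq_one_iff,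
    Set.mem_compl_iff, connEvent, Set.mem_setOf_eq, conn_01, conn_02, conn_03, conn_32,
    mem_cylinder_univ, σSN_zero, σSN_one, σSN_two]
  cases h0 : ω 0 <;> cases h1 : ω 1 <;> cases h2 : ω 2 <;> simp

/-! ### The four masses -/

/-- `u ≠ v`. -/
lemma one_ne_two : (1 : Fin 4) ≠ 2 := by decide

/-- The probability of a full cylinder on the three edges. -/
lemma prob_cylinder_univ (p : Fin 3 → ℝ) (σ : Config (Fin 3)) :
    prob p (cylinder Finset.univ σ) =
      edgeFactor (p 0) (σ 0) * edgeFactor (p 1) (σ 1) * edgeFactor (p 2) (σ 2) := by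
  rw [prob_cylinder, Fin.prod_univ_three]

/-- The probability of the cylinder on the edges `0` and `2`. -/
lemma prob_cylinder_02 (p : Fin 3 → ℝ) (σ : Config (Fin 3)) :
    prob p (cylinder ({0, 2} : Finset (Fin 3)) σ) =
      edgeFactor (p 0) (σ 0) * edgeFactor (p 2) (σ 2) := by
  rw [prob_cylinder, Finset.prod_insert (by decide), Finset.prod_singleton]

/-- The two-vertex status law of the path at a grid point. -/
noncomputable def M (p : Fin 3 → ℝ) (k : Fin 3 × Fin 3) : ℝ :=
  BoxUnionPair.pairLaw p pathEnds {1, 2} 0 3 (PairTP2.iota 1 2 k)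

/-- `M(S, T) = p₀ (1 − p₁) p₂`. -/
lemma M_ST (p : Fin 3 → ℝ) : M p (2, 0) = p 0 * (1 - p 1) * p 2 := by
  unfold M
  rw [PairTP2.mass_eq pathEnds 0 3 one_ne_two 2 0, gridEvent_ST, prob_cylinder_univ, σST_zero,
    σST_one, σST_two, edgeFactor_true, edgeFactor_false, edgeFactor_true]

/-- `M(N, N) = (1 − p₀)(1 − p₂)`: the interface edge is free. -/
lemma M_NN (p : Fin 3 → ℝ) : M p (1, 1) = (1 - p 0) * (1 - p 2) := by
  unfold M
  rw [PairTP2.mass_eq pathEnds 0 3 one_ne_two 1 1, gridEvent_NN, prob_cylinder_02, σNN_zero,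
    σNN_two, edgeFactor_false, edgeFactor_false]

/-- `M(N, T) = (1 − p₀)(1 − p₁) p₂`. -/
lemma M_NT (p : Fin 3 → ℝ) : M p (1, 0) = (1 - p 0) * (1 - p 1) * p 2 := by
  unfold M
  rw [PairTP2.mass_eq pathEnds 0 3 one_ne_two 1 0, gridEvent_NT, prob_cylinder_univ, σNT_zero,
    σNT_one, σNT_two, edgeFactor_false, edgeFactor_false, edgeFactor_true]

/-- `M(S, N) = p₀ (1 − p₁)(1 − p₂)`. -/
lemma M_SN (p : Fin 3 → ℝ) : M p (2, 1) = p 0 * (1 - p 1) * (1 - p 2) := by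
  unfold M
  rw [PairTP2.mass_eq pathEnds 0 3 one_ne_two 2 1, gridEvent_SN, prob_cylinder_univ, σSN_zero,
    σSN_one, σSN_two, edgeFactor_true, edgeFactor_false, edgeFactor_false]

/-! ### The minor and the failure of log-supermodularity -/

/-- **The free-interface minor of the path**:
`M(S,T) · M(N,N) − M(N,T) · M(S,N) = p₀ p₁ p₂ (1 − p₀)(1 − p₁)(1 − p₂)` for every weight vector. -/
theorem minor_eq (p : Fin 3 → ℝ) :
    M p (2, 0) * M p (1, 1) - M p (1, 0) * M p (2, 1) =
      p 0 * p 1 * p 2 * ((1 - p 0) * (1 - p 1) * (1 - p 2)) := by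
  rw [M_ST, M_NN, M_NT, M_SN]
  ring

/-- The minor is positive at every interior weight vector. -/
lemma minor_pos (p : Fin 3 → ℝ) (hp : ∀ e, 0 < p e ∧ p e < 1) :
    0 < M p (2, 0) * M p (1, 1) - M p (1, 0) * M p (2, 1) := by
  rw [minor_eq]
  have h0 := hp 0
  have h1 := hp 1
  have h2 := hp 2
  have : 0 < (1 - p 0) * (1 - p 1) * (1 - p 2) :=
    mul_pos (mul_pos (by linarith) (by linarith)) (by linarith)
  exact mul_pos (mul_pos (mul_pos h0.1 h1.1) h2.1) this

/-- **(PAIR-TP2) is sharp on the path `s – u – v – t`**: at every interior weight vector the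
two-vertex status law is NOT log-supermodular on the (Z)-lattice — the pair
`(S, T), (N, N)` violates the lattice condition. -/
theorem not_pairLaw_lsm (p : Fin 3 → ℝ) (hp : ∀ e, 0 < p e ∧ p e < 1) :
    ¬ ∀ x y : BoxUnionPair.ZLat (Fin 4),
      BoxUnionPair.pairLaw p pathEnds {1, 2} 0 3 x * BoxUnionPair.pairLaw p pathEnds {1, 2} 0 3 y ≤
        BoxUnionPair.pairLaw p pathEnds {1, 2} 0 3 (x ⊓ y) *
          BoxUnionPair.pairLaw p pathEnds {1, 2} 0 3 (x ⊔ y) := by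
  intro h
  have h' := h (PairTP2.iota 1 2 (2, 0)) (PairTP2.iota 1 2 (1, 1))
  rw [← PairTP2.iota_inf one_ne_two, ← PairTP2.iota_sup one_ne_two] at h'
  have hinf : ((2 : Fin 3), (0 : Fin 3)) ⊓ ((1 : Fin 3), (1 : Fin 3)) = (1, 0) := by decide
  have hsup : ((2 : Fin 3), (0 : Fin 3)) ⊔ ((1 : Fin 3), (1 : Fin 3)) = (2, 1) := by decide
  rw [hinf, hsup] at h'
  have hpos := minor_pos p hp
  unfold M at hpos
  linarith

/-! ### The path is linkable and interfaced -/

/-- `(u, v) = (1, 2)` IS linkable on the path: the configuration `(1, 0, 1)` has `s ↮ t`,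
`u ∈ C_s` and `v ∈ C_t`. -/
theorem not_notLinkable : ¬ PairTP2.NotLinkable pathEnds 0 3 1 2 := by
  intro h
  have hQ : σST ∈ (connEvent pathEnds 0 3)ᶜ := by
    simp only [Set.mem_compl_iff, connEvent, Set.mem_setOf_eq, conn_03, σST_one]
    simp
  exact (h σST hQ).1 ⟨conn_e0 σST_zero, conn_symm (conn_e2 σST_two)⟩

/-- `u = 1` and `v = 2` ARE interfaced on the path: they are adjacent in `G − {s, t}`. -/
theorem interfaced : (2 : Fin 4) ∈ Separated.comp pathEnds 0 3 1 := by
  show Conn pathEnds (Separated.base pathEnds 0 3) 1 2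
  apply conn_e1
  rw [Separated.base, induced_eq_true_iff]
  refine ⟨rfl, 1, ?_, 2, ?_, rfl⟩
  · simp only [Set.mem_compl_iff, Set.mem_insert_iff, Set.mem_singleton_iff]
    decide
  · simp only [Set.mem_compl_iff, Set.mem_insert_iff, Set.mem_singleton_iff]
    decide

/-- **The hypothesis of `pairLaw_lsm_of_not_linkable_or_not_interfaced` cannot be dropped**: on
the path the disjunction «not linkable or not interfaced» fails … -/
theorem hypothesis_fails :
    ¬ (PairTP2.NotLinkable pathEnds 0 3 1 2 ∨ (2 : Fin 4) ∉ Separated.comp pathEnds 0 3 1) := by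
  rintro (h | h)
  · exact not_notLinkable h
  · exact h interfaced

/-- … and so does the conclusion, at every interior weight vector (the two together: the
criterion (PAIR-TP2) is exact on its smallest instance). -/
theorem conclusion_fails (p : Fin 3 → ℝ) (hp : ∀ e, 0 < p e ∧ p e < 1) :
    ¬ (PairTP2.NotLinkable pathEnds 0 3 1 2 ∨ (2 : Fin 4) ∉ Separated.comp pathEnds 0 3 1) ∧
    ¬ ∀ x y : BoxUnionPair.ZLat (Fin 4),
      BoxUnionPair.pairLaw p pathEnds {1, 2} 0 3 x * BoxUnionPair.pairLaw p pathEnds {1, 2} 0 3 y ≤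
        BoxUnionPair.pairLaw p pathEnds {1, 2} 0 3 (x ⊓ y) *
          BoxUnionPair.pairLaw p pathEnds {1, 2} 0 3 (x ⊔ y) :=
  ⟨hypothesis_fails, not_pairLaw_lsm p hp⟩

end PairTP2Path

end Summit.Ventures.PercRepro2
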